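import Mathlib
import Summits.Ventures.LatticeQCDFlow.TrivializingMaps.FiniteRangeDecorrelation
import Summits.Ventures.LatticeQCDFlow.TrivializingMaps.TrivializingFlow
import Summits.Ventures.LatticeQCDFlow.Exactness.FlowAcceptanceOverlap
import HarnessLib

/-!
# The acceptance rate of a strictly local flow proposal bounds its footprint from below

HONEST FRAMING: exact (Metropolis-corrected) sampling algorithms for lattice gauge theory; figures of merit are
autocorrelation/cost numbers at stated couplings and volumes; no continuum-physics claim.

Venture `LatticeQCDFlow` (cell pub-lqcd), topic `TrivializingMaps`; FANOUT row 28 (theory-1), THEOREM Q of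
THEORY-1 §28.  NEW WORK of the cell — a composition of two tree theorems with the `L¹`/density glue proved
here; nothing is cited as a fact.  Printed counterparts, named only: Albergo–Kanwar–Shanahan 2019 §II.C and
Nicoli et al. 2020 (acceptance as the flow-quality figure), Lüscher 2010 §3.3 (footprint of truncated maps).

## What is proved (0 `sorry`)

Reference measure `μ` (s-finite), TARGET density `p ≥ 0` and MODEL density `q ≥ 0` w.r.t. `μ` (`π = p·μ`,
`ν = q·μ`); the independence (flow) sampler proposes `y ∼ ν` and accepts with `min(1, p(y)q(x)/(p(x)q(y)))`;
its EQUILIBRIUM ACCEPTANCE is `ā = ∫∫ min(p(x)q(y), p(y)q(x)) dμ dμ` (`Exactness.meanAccept_eq`).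
* §1 `integral_abs_sub_eq_two_mul` (`∫ |p - q| = 2 (1 - ∫ min(p, q))`), `integralClose_withDensity`
  (`π`, `ν` are `IntegralClose` with constant `∫ |p - q|`), **`integralClose_of_meanAccept`** (with the
  tree's `meanAccept_le_overlap`: `acc ≤ ā ⟹ IntegralClose π ν (2 (1 - acc))`), `abs_cov_le_of_meanAccept`.
* §2 **`abs_cov_le_of_meanAccept_of_range`** (THEOREM Q) — link fields `ι → α`, i.i.d. reference `μ₀^ι`;
  if the model law is the push-forward `Φ_* μ₀^ι` of a measurable map of RANGE `r` (output link `i` reads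
  input links within distance `r`) with density `q`, and the equilibrium acceptance is `≥ acc`, then every
  pair of measurable observables `|A| ≤ a`, `|B| ≤ b` supported more than `2r` apart has
  `|∫ A B ∂π - (∫ A ∂π)(∫ B ∂π)| ≤ 6 (1 - acc) a b`; **`sep_le_two_mul_range_of_meanAccept`** (FOOTPRINT
  LAW AT FIXED ACCEPTANCE) — a target witness pair at separation `sep` with connected correlation
  `≥ m > 6 (1 - acc) a b` forces `sep ≤ 2 r`.
* §3 **`Gauge.abs_cov_boltzmann_le_of_meanAccept`**, **`Gauge.sep_le_two_mul_range_of_meanAccept`** —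
  the lattice gauge instance `G = SU(n)`, `π = 𝒵⁻¹ e^{-S} D[U]` (`S` continuous), reference `D[U]`, model
  `Φ_* D[V]` with density `q`; `∫ q D[U] = 1` and integrability are DERIVED from the push-forward identity;
  `boltzmannMeasure_eq_withDensity`: `𝒵⁻¹ e^{-S} D[U]` is the real density `e^{-S}/𝒵` against `D[U]`.

READING (cost law, no numerics implied).  At fixed equilibrium acceptance `acc`, a strictly local flow
proposal has range `r ≥ sep/2` for EVERY separation `sep` at which the target still has a bounded witness
pair with connected correlation `> 6 (1 - acc) a b`; with a correlation length `ξ` (witnesses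
`|Cov| ≥ c e^{-sep/ξ}` up to `sep ≤ D`): `r ≥ ½ · min(D, ξ · log(c / (6 (1 - acc) a b)))` — the receptive
radius grows like `ξ(β) · log(1/(1 - acc))`, and like `ξ(β)` at any fixed `acc < 1`; for a depth-`k` Euler
integration of an order-`N` Lüscher generator `r = k (N + 1)` (`MapLocality`).  NOT CLAIMED: anything for
quasi-local (exponentially-tailed) maps (that is THEOREM C / R′); lower bounds on `ξ`; the converse; ESS.
-/

namespace Summit.Ventures.LatticeQCDFlow.TrivializingMaps

open MeasureTheory Set
open scoped ENNReal NNReal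

/-! ## §1. Densities: `L¹` distance, overlap, dual closeness, acceptance -/

section Densities

variable {X : Type*} [MeasurableSpace X] {μ : Measure X} {p q : X → ℝ}

/-- Integration against the real density `p ≥ 0`: `∫ h d(p·μ) = ∫ p h dμ`. -/
theorem integral_withDensity_ofReal_eq (hp0 : ∀ x, 0 ≤ p x) (hpm : Measurable p) (h : X → ℝ) :
    ∫ x, h x ∂(μ.withDensity fun x => ENNReal.ofReal (p x)) = ∫ x, p x * h x ∂μ := by
  have e : (fun x => ENNReal.ofReal (p x)) = fun x => ((p x).toNNReal : ℝ≥0∞) := rfl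
  rw [e, integral_withDensity_eq_integral_smul hpm.real_toNNReal]
  refine integral_congr_ae (Filter.Eventually.of_forall fun x => ?_)
  simp only [NNReal.smul_def, smul_eq_mul, Real.coe_toNNReal _ (hp0 x)]

/-- `p·μ` is a probability measure when `∫ p dμ = 1`. -/
theorem isProbabilityMeasure_withDensity_ofReal (hp0 : ∀ x, 0 ≤ p x) (hpi : Integrable p μ)
    (hp1 : ∫ x, p x ∂μ = 1) : IsProbabilityMeasure (μ.withDensity fun x => ENNReal.ofReal (p x)) := by
  refine ⟨?_⟩
  rw [withDensity_apply _ MeasurableSet.univ, Measure.restrict_univ,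
    ← ofReal_integral_eq_lintegral_ofReal hpi (Filter.Eventually.of_forall hp0), hp1, ENNReal.ofReal_one]

/-- A bounded measurable observable is integrable against an integrable density. -/
theorem integrable_density_mul (hpm : Measurable p) (hpi : Integrable p μ) {h : X → ℝ}
    (hm : Measurable h) {c : ℝ} (hb : ∀ x, |h x| ≤ c) : Integrable (fun x => p x * h x) μ :=
  Integrable.mono' (hpi.norm.mul_const c) (hpm.mul hm).aestronglyMeasurable
    (Filter.Eventually.of_forall fun x => by
      rw [Real.norm_eq_abs, abs_mul, Real.norm_eq_abs]
      exact mul_le_mul_of_nonneg_left (hb x) (abs_nonneg _))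

/-- **`L¹` distance = twice the total variation**: `∫ |p - q| dμ = 2 (1 - ∫ min(p, q) dμ)`. -/
theorem integral_abs_sub_eq_two_mul (hpi : Integrable p μ) (hp1 : ∫ x, p x ∂μ = 1)
    (hqi : Integrable q μ) (hq1 : ∫ x, q x ∂μ = 1) :
    ∫ x, |p x - q x| ∂μ = 2 * (1 - ∫ x, min (p x) (q x) ∂μ) := by
  have e : ∀ x, |p x - q x| = p x + q x - 2 * min (p x) (q x) := fun x => by
    rcases le_total (p x) (q x) with h | h
    · rw [min_eq_left h, abs_of_nonpos (sub_nonpos.2 h)]; ring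
    · rw [min_eq_right h, abs_of_nonneg (sub_nonneg.2 h)]; ring
  have hmi : Integrable (fun x => min (p x) (q x)) μ := hpi.inf hqi
  have hpq : Integrable (fun x => p x + q x) μ := hpi.add hqi
  simp_rw [e]
  rw [integral_sub hpq (hmi.const_mul 2), integral_add hpi hqi, integral_const_mul, hp1, hq1]
  ring

/-- **Densities `⟹` dual closeness**: `|∫ h d(p·μ) - ∫ h d(q·μ)| ≤ (∫ |p - q| dμ) · sup |h|`. -/
theorem integralClose_withDensity (hp0 : ∀ x, 0 ≤ p x) (hpm : Measurable p) (hpi : Integrable p μ)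
    (hq0 : ∀ x, 0 ≤ q x) (hqm : Measurable q) (hqi : Integrable q μ) :
    IntegralClose (μ.withDensity fun x => ENNReal.ofReal (p x))
      (μ.withDensity fun x => ENNReal.ofReal (q x)) (∫ x, |p x - q x| ∂μ) := by
  intro h c hm hc hb
  have hph := integrable_density_mul hpm hpi hm hb
  have hqh := integrable_density_mul hqm hqi hm hb
  rw [integral_withDensity_ofReal_eq hp0 hpm, integral_withDensity_ofReal_eq hq0 hqm,
    ← integral_sub hph hqh]
  calc |∫ x, (p x * h x - q x * h x) ∂μ| ≤ ∫ x, |p x * h x - q x * h x| ∂μ :=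
        abs_integral_le_integral_abs
    _ ≤ ∫ x, |p x - q x| * c ∂μ := by
        refine integral_mono (hph.sub hqh).abs ((hpi.sub hqi).abs.mul_const c) fun x => ?_
        dsimp only
        rw [← sub_mul, abs_mul]
        exact mul_le_mul_of_nonneg_left (hb x) (abs_nonneg _)
    _ = (∫ x, |p x - q x| ∂μ) * c := integral_mul_const _ _

/-- `IntegralClose` is monotone in the constant. -/
theorem IntegralClose.mono {π ν : Measure X} {ε ε' : ℝ} (hle : ε ≤ ε') (h : IntegralClose π ν ε) :
    IntegralClose π ν ε' := fun f c hf hc hb => (h f c hf hc hb).trans (mul_le_mul_of_nonneg_right hle hc)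

variable [SFinite μ]

/-- **THE ACCEPTANCE RATE CERTIFIES DUAL CLOSENESS.**  If the equilibrium acceptance
`ā = ∫∫ min(p(x)q(y), p(y)q(x)) dμ dμ` of the independence sampler with target `p·μ` and model `q·μ` is
at least `acc`, then `p·μ` and `q·μ` are `IntegralClose` with constant `2 (1 - acc)`:
every measurable observable bounded by `c` has `|⟨h⟩_π - ⟨h⟩_ν| ≤ 2 (1 - acc) c`. -/
theorem integralClose_of_meanAccept (hp0 : ∀ x, 0 ≤ p x) (hpm : Measurable p) (hpi : Integrable p μ)
    (hp1 : ∫ x, p x ∂μ = 1) (hq0 : ∀ x, 0 ≤ q x) (hqm : Measurable q) (hqi : Integrable q μ)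
    (hq1 : ∫ x, q x ∂μ = 1) {acc : ℝ}
    (hacc : acc ≤ ∫ x, ∫ y, min (p x * q y) (p y * q x) ∂μ ∂μ) :
    IntegralClose (μ.withDensity fun x => ENNReal.ofReal (p x))
      (μ.withDensity fun x => ENNReal.ofReal (q x)) (2 * (1 - acc)) := by
  have hov := Exactness.meanAccept_le_overlap (μ := μ) hp0 hpm hpi hp1 hq0 hqm hqi hq1
  refine IntegralClose.mono ?_ (integralClose_withDensity hp0 hpm hpi hq0 hqm hqi)
  rw [integral_abs_sub_eq_two_mul hpi hp1 hqi hq1]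
  linarith

/-- **Acceptance `⟹` clustering transfer (abstract).**  If `A`, `B` (`|A| ≤ a`, `|B| ≤ b` measurable) are
exactly uncorrelated under the model `q·μ` and the equilibrium acceptance is `≥ acc`, then `|Cov_π(A, B)| ≤ 6 (1 - acc) a b`. -/
theorem abs_cov_le_of_meanAccept (hp0 : ∀ x, 0 ≤ p x) (hpm : Measurable p) (hpi : Integrable p μ)
    (hp1 : ∫ x, p x ∂μ = 1) (hq0 : ∀ x, 0 ≤ q x) (hqm : Measurable q) (hqi : Integrable q μ)
    (hq1 : ∫ x, q x ∂μ = 1) {acc : ℝ}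
    (hacc : acc ≤ ∫ x, ∫ y, min (p x * q y) (p y * q x) ∂μ ∂μ) {A B : X → ℝ} (hAm : Measurable A)
    (hBm : Measurable B) {a b : ℝ} (hA : ∀ x, |A x| ≤ a) (hB : ∀ x, |B x| ≤ b)
    (hfac : ∫ x, A x * B x ∂(μ.withDensity fun x => ENNReal.ofReal (q x))
      = (∫ x, A x ∂(μ.withDensity fun x => ENNReal.ofReal (q x)))
        * ∫ x, B x ∂(μ.withDensity fun x => ENNReal.ofReal (q x))) :
    |∫ x, A x * B x ∂(μ.withDensity fun x => ENNReal.ofReal (p x))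
        - (∫ x, A x ∂(μ.withDensity fun x => ENNReal.ofReal (p x)))
          * ∫ x, B x ∂(μ.withDensity fun x => ENNReal.ofReal (p x))| ≤ 6 * (1 - acc) * (a * b) := by
  haveI := isProbabilityMeasure_withDensity_ofReal hp0 hpi hp1
  haveI := isProbabilityMeasure_withDensity_ofReal hq0 hqi hq1
  have h := abs_cov_le_of_integralClose _ _
    (integralClose_of_meanAccept hp0 hpm hpi hp1 hq0 hqm hqi hq1 hacc) hAm hBm hA hB hfac
  linarith

end Densities
/-! ## §2. THEOREM Q — strictly local push-forward proposals on link fields -/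

section Range

variable {ι : Type*} [Fintype ι] {α : Type*} [MeasurableSpace α]
variable (μ₀ : Measure α) [IsProbabilityMeasure μ₀]

/-- **THEOREM Q (acceptance bounds the footprint).**  Link fields `ι → α` with i.i.d. reference law
`μ₀^ι`; target `π = p · μ₀^ι`; model law the push-forward `Φ_* μ₀^ι` of a measurable map of RANGE `r`
(`Φ(W)(i)` depends only on `W` restricted to `N i ⊆ {j : d i j ≤ r}`) which has density `q` against `μ₀^ι`.
If the independence sampler's equilibrium acceptance is `≥ acc`, then every pair of measurable observables
`|A| ≤ a`, `|B| ≤ b` supported on sets `S`, `T` MORE THAN `2r` APART satisfies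
`|∫ A B ∂π - (∫ A ∂π)(∫ B ∂π)| ≤ 6 (1 - acc) a b`. -/
theorem abs_cov_le_of_meanAccept_of_range {p q : (ι → α) → ℝ} (hp0 : ∀ x, 0 ≤ p x)
    (hpm : Measurable p) (hpi : Integrable p (Measure.pi fun _ : ι => μ₀))
    (hp1 : ∫ x, p x ∂(Measure.pi fun _ : ι => μ₀) = 1) (hq0 : ∀ x, 0 ≤ q x) (hqm : Measurable q)
    (hqi : Integrable q (Measure.pi fun _ : ι => μ₀))
    (hq1 : ∫ x, q x ∂(Measure.pi fun _ : ι => μ₀) = 1)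
    (d : ι → ι → ℕ) (hsymm : ∀ a b, d a b = d b a) (htri : ∀ a b c, d a c ≤ d a b + d b c)
    {Φ : (ι → α) → (ι → α)} (hΦm : Measurable Φ)
    (hν : (Measure.pi fun _ : ι => μ₀).map Φ
      = (Measure.pi fun _ : ι => μ₀).withDensity fun x => ENNReal.ofReal (q x))
    {N : ι → Set ι} (hΦ : ∀ i, DependsOn (fun W => Φ W i) (N i)) {r : ℕ}
    (hN : ∀ i, ∀ j ∈ N i, d i j ≤ r) {acc : ℝ}
    (hacc : acc ≤ ∫ x, ∫ y, min (p x * q y) (p y * q x) ∂(Measure.pi fun _ : ι => μ₀)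
      ∂(Measure.pi fun _ : ι => μ₀))
    {A B : (ι → α) → ℝ} (hAm : Measurable A) (hBm : Measurable B) {a b : ℝ} (hAa : ∀ x, |A x| ≤ a)
    (hBb : ∀ x, |B x| ≤ b) {S T : Set ι} (hA : DependsOn A S) (hB : DependsOn B T)
    (hsep : ∀ i ∈ S, ∀ j ∈ T, 2 * r < d i j) :
    |∫ U, A U * B U ∂((Measure.pi fun _ : ι => μ₀).withDensity fun x => ENNReal.ofReal (p x))
        - (∫ U, A U ∂((Measure.pi fun _ : ι => μ₀).withDensity fun x => ENNReal.ofReal (p x)))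
          * ∫ U, B U ∂((Measure.pi fun _ : ι => μ₀).withDensity fun x => ENNReal.ofReal (p x))|
      ≤ 6 * (1 - acc) * (a * b) := by
  haveI := isProbabilityMeasure_withDensity_ofReal hp0 hpi hp1
  have hclose : IntegralClose ((Measure.pi fun _ : ι => μ₀).withDensity fun x => ENNReal.ofReal (p x))
      ((Measure.pi fun _ : ι => μ₀).map Φ) (2 * (1 - acc)) := by
    rw [hν]
    exact integralClose_of_meanAccept hp0 hpm hpi hp1 hq0 hqm hqi hq1 hacc
  have h := abs_cov_le_of_integralClose_pushforward μ₀ _ d hsymm htri hΦm hΦ hN hclose hAm hBm hAa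
    hBb hA hB hsep
  linarith

/-- **FOOTPRINT LAW AT FIXED ACCEPTANCE (contrapositive of THEOREM Q).**  Same setting; if two witnesses
supported AT LEAST `sep` apart have connected correlation `≥ m` under the target, and `m > 6 (1 - acc) a b`,
then `sep ≤ 2 r`: the proposal's range is at least half of every separation at which the target still
correlates above `6 (1 - acc) a b`.  With `m = c e^{-sep/ξ}`: `2 r ≥ sep` whenever
`sep < ξ log (c / (6 (1 - acc) a b))`. -/
theorem sep_le_two_mul_range_of_meanAccept {p q : (ι → α) → ℝ} (hp0 : ∀ x, 0 ≤ p x)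
    (hpm : Measurable p) (hpi : Integrable p (Measure.pi fun _ : ι => μ₀))
    (hp1 : ∫ x, p x ∂(Measure.pi fun _ : ι => μ₀) = 1) (hq0 : ∀ x, 0 ≤ q x) (hqm : Measurable q)
    (hqi : Integrable q (Measure.pi fun _ : ι => μ₀))
    (hq1 : ∫ x, q x ∂(Measure.pi fun _ : ι => μ₀) = 1)
    (d : ι → ι → ℕ) (hsymm : ∀ a b, d a b = d b a) (htri : ∀ a b c, d a c ≤ d a b + d b c)
    {Φ : (ι → α) → (ι → α)} (hΦm : Measurable Φ)
    (hν : (Measure.pi fun _ : ι => μ₀).map Φ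
      = (Measure.pi fun _ : ι => μ₀).withDensity fun x => ENNReal.ofReal (q x))
    {N : ι → Set ι} (hΦ : ∀ i, DependsOn (fun W => Φ W i) (N i)) {r : ℕ}
    (hN : ∀ i, ∀ j ∈ N i, d i j ≤ r) {acc : ℝ}
    (hacc : acc ≤ ∫ x, ∫ y, min (p x * q y) (p y * q x) ∂(Measure.pi fun _ : ι => μ₀)
      ∂(Measure.pi fun _ : ι => μ₀))
    {A B : (ι → α) → ℝ} (hAm : Measurable A) (hBm : Measurable B) {a b : ℝ} (hAa : ∀ x, |A x| ≤ a)
    (hBb : ∀ x, |B x| ≤ b) {S T : Set ι} (hA : DependsOn A S) (hB : DependsOn B T) {sep : ℕ}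
    (hfar : ∀ i ∈ S, ∀ j ∈ T, sep ≤ d i j) {m : ℝ}
    (hm : m ≤ |∫ U, A U * B U ∂((Measure.pi fun _ : ι => μ₀).withDensity fun x => ENNReal.ofReal (p x))
        - (∫ U, A U ∂((Measure.pi fun _ : ι => μ₀).withDensity fun x => ENNReal.ofReal (p x)))
          * ∫ U, B U ∂((Measure.pi fun _ : ι => μ₀).withDensity fun x => ENNReal.ofReal (p x))|)
    (hacc_m : 6 * (1 - acc) * (a * b) < m) : sep ≤ 2 * r := by
  haveI := isProbabilityMeasure_withDensity_ofReal hp0 hpi hp1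
  have hclose : IntegralClose ((Measure.pi fun _ : ι => μ₀).withDensity fun x => ENNReal.ofReal (p x))
      ((Measure.pi fun _ : ι => μ₀).map Φ) (2 * (1 - acc)) := by
    rw [hν]
    exact integralClose_of_meanAccept hp0 hpm hpi hp1 hq0 hqm hqi hq1 hacc
  exact sep_le_two_mul_range μ₀ _ d hsymm htri hΦm hΦ hN hclose hAm hBm hAa hBb hA hB hfar hm
    (by linarith)

end Range

/-! ## §3. The lattice gauge instance: `π = 𝒵⁻¹ e^{-S} D[U]` on `SU(n)` link fields -/

namespace Gauge

open Literature.MathematicalPhysics.QuantumFieldTheory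
open Literature.MathematicalPhysics.QuantumFieldTheory.Luscher2010

variable {d L n : ℕ} [NeZero L]

/-- Continuous real functions of `SU(n)` link fields are measurable (`SU(n)` is second countable). -/
theorem measurable_of_continuous
    {S : GaugeConfig d L (Matrix.specialUnitaryGroup (Fin n) ℂ) → ℝ} (hS : Continuous S) :
    Measurable S := by
  haveI : SecondCountableTopology (Matrix (Fin n) (Fin n) ℂ) :=
    inferInstanceAs (SecondCountableTopology (Fin n → Fin n → ℂ))
  haveI : SecondCountableTopology (Matrix.specialUnitaryGroup (Fin n) ℂ) :=
    Topology.IsEmbedding.subtypeVal.secondCountableTopology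
  exact hS.measurable

/-- `𝒵⁻¹ e^{-S} D[U]` IS the real density `e^{-S}/𝒵` against `D[U]` (`S` continuous, so `0 < 𝒵 < ∞`). -/
theorem boltzmannMeasure_eq_withDensity
    {S : GaugeConfig d L (Matrix.specialUnitaryGroup (Fin n) ℂ) → ℝ} (hS : Continuous S) :
    boltzmannMeasure S = (trivialMeasure (Matrix.specialUnitaryGroup (Fin n) ℂ) d L).withDensity
      fun U => ENNReal.ofReal (Real.exp (-S U) / (partitionFn S).toReal) := by
  obtain ⟨hZ0, hZtop⟩ := partitionFn_ne_zero_and_ne_top (d := d) (L := L) hS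
  have hz : 0 < (partitionFn S).toReal := ENNReal.toReal_pos hZ0 hZtop
  have hinv : (partitionFn S)⁻¹ = ENNReal.ofReal ((partitionFn S).toReal⁻¹) := by
    rw [ENNReal.ofReal_inv_of_pos hz, ENNReal.ofReal_toReal hZtop]
  have e : (fun U => ENNReal.ofReal (Real.exp (-S U) / (partitionFn S).toReal))
      = (partitionFn S)⁻¹ • fun U => ENNReal.ofReal (Real.exp (-S U)) := by
    funext U
    rw [Pi.smul_apply, smul_eq_mul, hinv, div_eq_inv_mul, ENNReal.ofReal_mul (inv_pos.2 hz).le]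
  have hm : Measurable fun U => ENNReal.ofReal (Real.exp (-S U)) :=
    ((measurable_of_continuous hS).neg.exp).ennreal_ofReal
  rw [e, withDensity_smul _ hm]
  rfl

/-- The density `e^{-S}/𝒵` is nonnegative, measurable, integrable and has unit mass against `D[U]`. -/
theorem density_boltzmann_spec
    {S : GaugeConfig d L (Matrix.specialUnitaryGroup (Fin n) ℂ) → ℝ} (hS : Continuous S) :
    (∀ U, 0 ≤ Real.exp (-S U) / (partitionFn S).toReal)
      ∧ Measurable (fun U => Real.exp (-S U) / (partitionFn S).toReal)
      ∧ Integrable (fun U => Real.exp (-S U) / (partitionFn S).toReal)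
          (trivialMeasure (Matrix.specialUnitaryGroup (Fin n) ℂ) d L)
      ∧ ∫ U, Real.exp (-S U) / (partitionFn S).toReal
          ∂(trivialMeasure (Matrix.specialUnitaryGroup (Fin n) ℂ) d L) = 1 := by
  haveI : IsProbabilityMeasure (trivialMeasure (Matrix.specialUnitaryGroup (Fin n) ℂ) d L) := by
    unfold trivialMeasure; infer_instance
  obtain ⟨hZ0, hZtop⟩ := partitionFn_ne_zero_and_ne_top (d := d) (L := L) hS
  have hz : 0 < (partitionFn S).toReal := ENNReal.toReal_pos hZ0 hZtop
  have hmeas : Measurable fun U => Real.exp (-S U) / (partitionFn S).toReal :=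
    (measurable_of_continuous hS).neg.exp.div_const _
  have h0 : ∀ U, 0 ≤ Real.exp (-S U) / (partitionFn S).toReal :=
    fun U => div_nonneg (Real.exp_pos _).le hz.le
  obtain ⟨C, hC⟩ := isCompact_univ.exists_bound_of_continuousOn hS.continuousOn
  have hC' : ∀ U, |S U| ≤ C := fun U => by simpa [Real.norm_eq_abs] using hC U (Set.mem_univ U)
  have hint : Integrable (fun U => Real.exp (-S U) / (partitionFn S).toReal)
      (trivialMeasure (Matrix.specialUnitaryGroup (Fin n) ℂ) d L) := by
    refine Integrable.mono' (integrable_const (Real.exp C / (partitionFn S).toReal))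
      hmeas.aestronglyMeasurable (Filter.Eventually.of_forall fun U => ?_)
    rw [Real.norm_eq_abs, abs_of_nonneg (h0 U)]
    exact div_le_div_of_nonneg_right (Real.exp_le_exp.2 (by linarith [(abs_le.1 (hC' U)).1])) hz.le
  refine ⟨h0, hmeas, hint, ?_⟩
  have hexp : ∫ U, Real.exp (-S U) ∂(trivialMeasure (Matrix.specialUnitaryGroup (Fin n) ℂ) d L)
      = (partitionFn S).toReal := by
    have hmS : Measurable fun U => Real.exp (-S U) := (measurable_of_continuous hS).neg.exp
    rw [integral_eq_lintegral_of_nonneg_ae (Filter.Eventually.of_forall fun U => (Real.exp_pos _).le)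
      hmS.aestronglyMeasurable]
    rfl
  simp_rw [div_eq_mul_inv]
  rw [integral_mul_const, hexp, mul_inv_cancel₀ hz.ne']

/-- A push-forward of `D[V]` with density `q ≥ 0` (measurable): `q` is integrable with `∫ q D[U] = 1`. -/
theorem integrable_of_map_eq_withDensity
    {Φ : GaugeConfig d L (Matrix.specialUnitaryGroup (Fin n) ℂ) →
      GaugeConfig d L (Matrix.specialUnitaryGroup (Fin n) ℂ)} (hΦm : Measurable Φ)
    {q : GaugeConfig d L (Matrix.specialUnitaryGroup (Fin n) ℂ) → ℝ} (hq0 : ∀ U, 0 ≤ q U)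
    (hqm : Measurable q)
    (hν : (trivialMeasure (Matrix.specialUnitaryGroup (Fin n) ℂ) d L).map Φ
      = (trivialMeasure (Matrix.specialUnitaryGroup (Fin n) ℂ) d L).withDensity
          fun U => ENNReal.ofReal (q U)) :
    Integrable q (trivialMeasure (Matrix.specialUnitaryGroup (Fin n) ℂ) d L)
      ∧ ∫ U, q U ∂(trivialMeasure (Matrix.specialUnitaryGroup (Fin n) ℂ) d L) = 1 := by
  haveI : IsProbabilityMeasure (trivialMeasure (Matrix.specialUnitaryGroup (Fin n) ℂ) d L) := by
    unfold trivialMeasure; infer_instance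
  have hlin : ∫⁻ U, ENNReal.ofReal (q U) ∂(trivialMeasure (Matrix.specialUnitaryGroup (Fin n) ℂ) d L)
      = 1 := by
    rw [← setLIntegral_univ, ← withDensity_apply _ MeasurableSet.univ, ← hν,
      Measure.map_apply hΦm MeasurableSet.univ, Set.preimage_univ, measure_univ]
  have hint : Integrable q (trivialMeasure (Matrix.specialUnitaryGroup (Fin n) ℂ) d L) :=
    ⟨hqm.aestronglyMeasurable,
      (hasFiniteIntegral_iff_ofReal (Filter.Eventually.of_forall hq0)).2 (by simp [hlin])⟩
  refine ⟨hint, ?_⟩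
  rw [integral_eq_lintegral_of_nonneg_ae (Filter.Eventually.of_forall hq0) hqm.aestronglyMeasurable,
    hlin, ENNReal.toReal_one]

/-- **THEOREM Q for lattice gauge theory.**  `G = SU(n)`, continuous action `S`, target `π = 𝒵⁻¹ e^{-S} D[U]`;
a measurable proposal map `Φ` of RANGE `r` for a distance `dist` on links (symmetric, triangle inequality)
whose push-forward `Φ_* D[V]` has density `q ≥ 0` against `D[U]`; the independence Metropolis sampler on it
(exact for `π`) has equilibrium acceptance `∫∫ min(p(U)q(U'), p(U')q(U)) D[U] D[U'] ≥ acc`, `p = e^{-S}/𝒵`.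
Then for all measurable `|A| ≤ a`, `|B| ≤ b` depending on link sets `SA`, `SB` more than `2r` apart:
`|⟨A B⟩ - ⟨A⟩⟨B⟩| ≤ 6 (1 - acc) a b` (expectations in `π`). -/
theorem abs_cov_boltzmann_le_of_meanAccept
    {S : GaugeConfig d L (Matrix.specialUnitaryGroup (Fin n) ℂ) → ℝ} (hS : Continuous S)
    (dist : Edge d L → Edge d L → ℕ) (hsymm : ∀ e e', dist e e' = dist e' e)
    (htri : ∀ e e' e'', dist e e'' ≤ dist e e' + dist e' e'')
    {Φ : GaugeConfig d L (Matrix.specialUnitaryGroup (Fin n) ℂ) →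
      GaugeConfig d L (Matrix.specialUnitaryGroup (Fin n) ℂ)} (hΦm : Measurable Φ)
    {q : GaugeConfig d L (Matrix.specialUnitaryGroup (Fin n) ℂ) → ℝ} (hq0 : ∀ U, 0 ≤ q U)
    (hqm : Measurable q)
    (hν : (trivialMeasure (Matrix.specialUnitaryGroup (Fin n) ℂ) d L).map Φ
      = (trivialMeasure (Matrix.specialUnitaryGroup (Fin n) ℂ) d L).withDensity
          fun U => ENNReal.ofReal (q U))
    {N : Edge d L → Set (Edge d L)} (hΦ : ∀ e, DependsOn (fun W => Φ W e) (N e)) {r : ℕ}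
    (hN : ∀ e, ∀ e' ∈ N e, dist e e' ≤ r) {acc : ℝ}
    (hacc : acc ≤ ∫ U, ∫ U', min (Real.exp (-S U) / (partitionFn S).toReal * q U')
        (Real.exp (-S U') / (partitionFn S).toReal * q U)
        ∂(trivialMeasure (Matrix.specialUnitaryGroup (Fin n) ℂ) d L)
        ∂(trivialMeasure (Matrix.specialUnitaryGroup (Fin n) ℂ) d L))
    {A B : GaugeConfig d L (Matrix.specialUnitaryGroup (Fin n) ℂ) → ℝ} (hAm : Measurable A)
    (hBm : Measurable B) {a b : ℝ} (hAa : ∀ U, |A U| ≤ a) (hBb : ∀ U, |B U| ≤ b)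
    {SA SB : Set (Edge d L)} (hA : DependsOn A SA) (hB : DependsOn B SB)
    (hsep : ∀ e ∈ SA, ∀ e' ∈ SB, 2 * r < dist e e') :
    |∫ U, A U * B U ∂(boltzmannMeasure S)
        - (∫ U, A U ∂(boltzmannMeasure S)) * ∫ U, B U ∂(boltzmannMeasure S)|
      ≤ 6 * (1 - acc) * (a * b) := by
  obtain ⟨hp0, hpm, hpi, hp1⟩ := density_boltzmann_spec (d := d) (L := L) hS
  obtain ⟨hqi, hq1⟩ := integrable_of_map_eq_withDensity (d := d) (L := L) hΦm hq0 hqm hν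
  rw [boltzmannMeasure_eq_withDensity hS]
  unfold trivialMeasure at hpi hp1 hqi hq1 hν hacc ⊢
  exact abs_cov_le_of_meanAccept_of_range (haarProbability (Matrix.specialUnitaryGroup (Fin n) ℂ))
    hp0 hpm hpi hp1 hq0 hqm hqi hq1 dist hsymm htri hΦm hν hΦ hN hacc hAm hBm hAa hBb hA hB hsep

/-- **FOOTPRINT LAW for lattice gauge theory.**  Same setting; a witness pair at separation `≥ sep` with
connected correlation `≥ m > 6 (1 - acc) a b` under `𝒵⁻¹ e^{-S} D[U]` forces `sep ≤ 2 r`. -/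
theorem sep_le_two_mul_range_of_meanAccept
    {S : GaugeConfig d L (Matrix.specialUnitaryGroup (Fin n) ℂ) → ℝ} (hS : Continuous S)
    (dist : Edge d L → Edge d L → ℕ) (hsymm : ∀ e e', dist e e' = dist e' e)
    (htri : ∀ e e' e'', dist e e'' ≤ dist e e' + dist e' e'')
    {Φ : GaugeConfig d L (Matrix.specialUnitaryGroup (Fin n) ℂ) →
      GaugeConfig d L (Matrix.specialUnitaryGroup (Fin n) ℂ)} (hΦm : Measurable Φ)
    {q : GaugeConfig d L (Matrix.specialUnitaryGroup (Fin n) ℂ) → ℝ} (hq0 : ∀ U, 0 ≤ q U)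
    (hqm : Measurable q)
    (hν : (trivialMeasure (Matrix.specialUnitaryGroup (Fin n) ℂ) d L).map Φ
      = (trivialMeasure (Matrix.specialUnitaryGroup (Fin n) ℂ) d L).withDensity
          fun U => ENNReal.ofReal (q U))
    {N : Edge d L → Set (Edge d L)} (hΦ : ∀ e, DependsOn (fun W => Φ W e) (N e)) {r : ℕ}
    (hN : ∀ e, ∀ e' ∈ N e, dist e e' ≤ r) {acc : ℝ}
    (hacc : acc ≤ ∫ U, ∫ U', min (Real.exp (-S U) / (partitionFn S).toReal * q U')
        (Real.exp (-S U') / (partitionFn S).toReal * q U)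
        ∂(trivialMeasure (Matrix.specialUnitaryGroup (Fin n) ℂ) d L)
        ∂(trivialMeasure (Matrix.specialUnitaryGroup (Fin n) ℂ) d L))
    {A B : GaugeConfig d L (Matrix.specialUnitaryGroup (Fin n) ℂ) → ℝ} (hAm : Measurable A)
    (hBm : Measurable B) {a b : ℝ} (hAa : ∀ U, |A U| ≤ a) (hBb : ∀ U, |B U| ≤ b)
    {SA SB : Set (Edge d L)} (hA : DependsOn A SA) (hB : DependsOn B SB) {sep : ℕ}
    (hfar : ∀ e ∈ SA, ∀ e' ∈ SB, sep ≤ dist e e') {m : ℝ}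
    (hm : m ≤ |∫ U, A U * B U ∂(boltzmannMeasure S)
        - (∫ U, A U ∂(boltzmannMeasure S)) * ∫ U, B U ∂(boltzmannMeasure S)|)
    (hacc_m : 6 * (1 - acc) * (a * b) < m) : sep ≤ 2 * r := by
  by_contra hcon
  have hsep : ∀ e ∈ SA, ∀ e' ∈ SB, 2 * r < dist e e' :=
    fun e he e' he' => lt_of_lt_of_le (not_le.1 hcon) (hfar e he e' he')
  exact absurd (hm.trans (abs_cov_boltzmann_le_of_meanAccept hS dist hsymm htri hΦm hq0 hqm hν hΦ hN
    hacc hAm hBm hAa hBb hA hB hsep)) (not_le.2 hacc_m)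

end Gauge

end Summit.Ventures.LatticeQCDFlow.TrivializingMaps
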